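import Mathlib

/-!
# Twisted traces vanish: `M^(2n+1) = 333^n·M` with `37 ∤ n` forces `tr M = 0` (kernel; elementary Frobenius route)

Framing: lottery ticket; floor = certified bounds/negative ranges.  Cell pub-namedobj (venture DiscreteObjects),
target (H) = `H(668)`, hadamard gen 29; the tool behind the GALOIS REFINEMENT of the automorphism census of
`srg(333,166,82,83)` ⇔ symmetric `C(334)` (⇒ `H(668)`).  For the Seidel matrix `S` (`S² = 333·I − J`, `S𝟙 = 0`) and an
automorphism `σ` of order `n`, the twisted matrix `M = P_σ S` satisfies `M^(2n+1) = 333^n·M`; its complex eigenvalues are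
`0` or `√333·ζ` with `ζ^(2n) = 1`, so `tr M ≠ 0` would put `√37 ∈ ℚ(ζ_{2n})`, impossible when `37 ∤ n` (conductor `37`).
Here that Galois statement is replaced by an ELEMENTARY finite-field argument (no cyclotomic fields in the kernel):
* **`pow_odd_eq_smul_of_pow_eq_smul`** — `M^(2n+1) = c^n·M` gives `M^(2nr+1) = c^(nr)·M` (any commutative ring).
* **`zmod_trace_eq_zero_of_pow_eq_smul`** — over `𝔽_ℓ`, `ℓ = 2nr + 1` prime, `c^(nr) = −1` (i.e. `c` a non-residue,
  Euler): `M^ℓ = −M`, while `tr(M^ℓ) = (tr M)^ℓ = tr M` (Frobenius; Mathlib `ZMod.trace_pow_card`), so `tr M = 0`.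
* **`prime_dvd_trace_of_pow_eq_smul`** — hence for an INTEGER matrix with `M^(2n+1) = c^n·M`: `ℓ ∣ tr M` for every such
  prime `ℓ`.
* **`exists_prime_nonresidue_333`** — for `37 ∤ n` there are arbitrarily large primes `ℓ ≡ 1 (mod 2n)` with `333` a
  non-residue mod `ℓ`: Dirichlet (Mathlib `Nat.forall_exists_prime_gt_and_eq_mod`) in the class `ℓ ≡ 1 (2n), ℓ ≡ 2 (37)`
  and quadratic reciprocity (`(333/ℓ) = (37/ℓ) = (ℓ/37) = (2/37) = −1`, `37 ≡ 5 (mod 8)`).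
* **`trace_eq_zero_of_pow_eq_smul_333`** — THE TOOL: an integer square matrix with `M^(2n+1) = 333^n·M`, `37 ∤ n`, has
  `tr M = 0` (take `ℓ > |tr M|`).  For `n = 1` this is `ClassSumTrace.trace_eq_zero_of_mul_mul_eq_smul` at `c = 333`.
Ours (standard ingredients: Frobenius on traces, Euler's criterion, reciprocity, Dirichlet); Mathlib only; no `sorry`,
no new definitions.  Nothing here constructs or excludes `H(668)`.
-/

namespace Summit.Ventures.DiscreteObjects.Hadamard

open Matrix

section frobenius
variable {ι : Type*} [Fintype ι] [DecidableEq ι]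

/-- `M^(2n+1) = c^n • M` propagates to `M^(2nr+1) = c^(nr) • M`. -/
theorem pow_odd_eq_smul_of_pow_eq_smul {R : Type*} [CommRing R] (M : Matrix ι ι R) (c : R) (n : ℕ)
    (hM : M ^ (2 * n + 1) = c ^ n • M) (r : ℕ) : M ^ (2 * n * r + 1) = c ^ (n * r) • M := by
  induction r with
  | zero => simp
  | succ r ih =>
    have e1 : 2 * n * (r + 1) + 1 = (2 * n * r + 1) + 2 * n := by ring
    have e2 : n * (r + 1) = n * r + n := by ring
    rw [e1, pow_add, ih, smul_mul_assoc, ← pow_succ', hM, smul_smul, e2, pow_add]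

/-- **Frobenius step.**  Over `𝔽_ℓ` with `ℓ = 2nr + 1` prime: `M^(2n+1) = c^n • M` and `c^(nr) = −1` force `tr M = 0`
(`M^ℓ = −M` but `tr(M^ℓ) = (tr M)^ℓ = tr M`). -/
theorem zmod_trace_eq_zero_of_pow_eq_smul {ℓ : ℕ} [hℓ : Fact ℓ.Prime] (M : Matrix ι ι (ZMod ℓ)) (c : ZMod ℓ)
    (n r : ℕ) (hℓr : ℓ = 2 * n * r + 1) (hM : M ^ (2 * n + 1) = c ^ n • M) (hc : c ^ (n * r) = -1) :
    M.trace = 0 := by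
  have h1 : M ^ ℓ = -M := by
    have e : M ^ ℓ = M ^ (2 * n * r + 1) := congrArg (fun a : ℕ => M ^ a) hℓr
    rw [e, pow_odd_eq_smul_of_pow_eq_smul M c n hM r, hc, neg_smul, one_smul]
  have h2 : (M ^ ℓ).trace = M.trace ^ ℓ := ZMod.trace_pow_card M
  rw [h1, Matrix.trace_neg, ZMod.pow_card] at h2
  have hk : ∃ k, ℓ = 2 * k + 1 := ⟨n * r, by rw [hℓr]; ring⟩
  obtain ⟨k, hk⟩ := hk
  have h2ne : (2 : ZMod ℓ) ≠ 0 := by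
    intro h
    have h' : ((2 : ℕ) : ZMod ℓ) = 0 := by exact_mod_cast h
    rw [ZMod.natCast_eq_zero_iff] at h'
    have := Nat.le_of_dvd (by norm_num) h'
    have := hℓ.out.two_le
    omega
  have h3 : (2 : ZMod ℓ) * M.trace = 0 := by linear_combination -h2
  exact (mul_eq_zero.mp h3).resolve_left h2ne

/-- **Integer form.**  An integer matrix with `M^(2n+1) = c^n • M`: every prime `ℓ = 2nr + 1` modulo which
`c^(nr) ≡ −1` divides `tr M`. -/
theorem prime_dvd_trace_of_pow_eq_smul {ℓ : ℕ} (hℓ : ℓ.Prime) (M : Matrix ι ι ℤ) (c : ℤ) (n r : ℕ)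
    (hℓr : ℓ = 2 * n * r + 1) (hM : M ^ (2 * n + 1) = c ^ n • M) (hc : (c : ZMod ℓ) ^ (n * r) = -1) :
    (ℓ : ℤ) ∣ M.trace := by
  haveI : Fact ℓ.Prime := ⟨hℓ⟩
  set f : ℤ →+* ZMod ℓ := Int.castRingHom (ZMod ℓ) with hf
  have hMb : (M.map f) ^ (2 * n + 1) = (c : ZMod ℓ) ^ n • (M.map f) := by
    have h : (M ^ (2 * n + 1)).map f = (c ^ n • M).map f := by rw [hM]
    rw [Matrix.map_pow] at h
    rw [h]
    ext i j
    rw [Matrix.map_apply, Matrix.smul_apply, Matrix.smul_apply, Matrix.map_apply, smul_eq_mul, smul_eq_mul,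
      map_mul, map_pow, eq_intCast f c]
  have htr := zmod_trace_eq_zero_of_pow_eq_smul (M.map f) (c : ZMod ℓ) n r hℓr hMb hc
  have hcast : (M.map f).trace = f M.trace := (AddMonoidHom.map_trace f.toAddMonoidHom M).symm
  rw [hcast, hf, eq_intCast] at htr
  exact (ZMod.intCast_zmod_eq_zero_iff_dvd _ _).mp htr

end frobenius

/-! ## §2 The primes: Dirichlet + reciprocity for `c = 333 = 9·37` -/

section primes

/-- `2` is not a square modulo `37` (`37 ≡ 5 (mod 8)`), as a Legendre symbol. -/
theorem legendreSym_37_two : @legendreSym 37 ⟨by norm_num⟩ 2 = -1 := by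
  haveI : Fact (Nat.Prime 37) := ⟨by norm_num⟩
  rw [legendreSym.eq_neg_one_iff]
  have e : ((2 : ℤ) : ZMod 37) = 2 := by norm_num
  rw [e, ZMod.exists_sq_eq_two_iff (by norm_num)]
  norm_num

/-- **The primes exist.**  For `37 ∤ n` and any bound `B` there is a prime `ℓ > B`, `ℓ > 333`, with `ℓ = 2nr + 1` and
`333^(nr) ≡ −1 (mod ℓ)` (i.e. `ℓ ≡ 1 (mod 2n)` and `333` a quadratic non-residue mod `ℓ`).  Dirichlet's theorem in the
class `ℓ ≡ 1 (mod 2n), ℓ ≡ 2 (mod 37)` and reciprocity: `(333/ℓ) = (37/ℓ) = (ℓ/37) = (2/37) = −1`. -/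
theorem exists_prime_nonresidue_333 (n : ℕ) (h37 : ¬ 37 ∣ n) (B : ℕ) :
    ∃ ℓ r : ℕ, ℓ.Prime ∧ B < ℓ ∧ 333 < ℓ ∧ ℓ = 2 * n * r + 1 ∧ ((333 : ℤ) : ZMod ℓ) ^ (n * r) = -1 := by
  have hn : 0 < n := Nat.pos_of_ne_zero (fun h => h37 (h ▸ dvd_zero 37))
  -- the residue class: k ≡ 1 (mod 2n), k ≡ 2 (mod 37)
  have hco : Nat.Coprime (2 * n) 37 := by
    rw [Nat.coprime_comm, Nat.Prime.coprime_iff_not_dvd (by norm_num)]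
    intro h
    have h2 : 37 ∣ 2 * n := h
    rcases (Nat.Prime.dvd_mul (by norm_num : Nat.Prime 37)).mp h2 with h | h
    · omega
    · exact h37 h
  obtain ⟨k, hk1, hk2⟩ := Nat.chineseRemainder hco 1 2
  set q : ℕ := 2 * n * 37 with hq
  have hq0 : q ≠ 0 := by rw [hq]; positivity
  haveI : NeZero q := ⟨hq0⟩
  have hku : IsUnit (k : ZMod q) := by
    rw [ZMod.isUnit_iff_coprime, hq]
    refine Nat.Coprime.mul_right ?_ ?_
    · rw [Nat.Coprime, hk1.gcd_eq]; simp
    · rw [Nat.Coprime, hk2.gcd_eq]; rfl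
  obtain ⟨ℓ, hℓB, hℓp, hℓk⟩ := Nat.forall_exists_prime_gt_and_eq_mod hku (max B 333)
  have hℓk' : ℓ ≡ k [MOD q] := (ZMod.natCast_eq_natCast_iff _ _ _).mp hℓk
  have hℓ1 : ℓ ≡ 1 [MOD 2 * n] := (hℓk'.of_mul_right 37).trans hk1
  have hℓ2 : ℓ ≡ 2 [MOD 37] := (hℓk'.of_mul_left (2 * n)).trans hk2
  have hB' : B < ℓ := lt_of_le_of_lt (le_max_left _ _) hℓB
  have h333 : 333 < ℓ := lt_of_le_of_lt (le_max_right _ _) hℓB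
  -- ℓ = 2 n r + 1
  have hdvd : 2 * n ∣ ℓ - 1 := (Nat.modEq_iff_dvd' (by omega)).mp hℓ1.symm
  obtain ⟨r, hr⟩ := hdvd
  have hℓr : ℓ = 2 * n * r + 1 := by omega
  refine ⟨ℓ, r, hℓp, hB', h333, hℓr, ?_⟩
  -- Euler + reciprocity
  haveI : Fact ℓ.Prime := ⟨hℓp⟩
  haveI : Fact (Nat.Prime 37) := ⟨by norm_num⟩
  have hℓne2 : ℓ ≠ 2 := by omega
  have h3 : ((3 : ℤ) : ZMod ℓ) ≠ 0 := by
    intro h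
    rw [ZMod.intCast_zmod_eq_zero_iff_dvd] at h
    have := Int.le_of_dvd (by norm_num) h
    omega
  have hL9 : legendreSym ℓ 9 = 1 := by
    have e : (9 : ℤ) = 3 ^ 2 := by norm_num
    rw [e]
    exact legendreSym.sq_one' ℓ h3
  have hL37 : legendreSym ℓ 37 = -1 := by
    have hrec : legendreSym ℓ ((37 : ℕ) : ℤ) = legendreSym 37 ((ℓ : ℕ) : ℤ) :=
      legendreSym.quadratic_reciprocity_one_mod_four (p := 37) (q := ℓ) (by norm_num) hℓne2
    have e37 : ((37 : ℕ) : ℤ) = 37 := rfl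
    rw [e37] at hrec
    rw [hrec, legendreSym.mod]
    have e : ((ℓ : ℤ) % ((37 : ℕ) : ℤ)) = 2 := by
      have : ℓ % 37 = 2 := hℓ2
      push_cast
      omega
    rw [e]
    exact legendreSym_37_two
  have hL333 : legendreSym ℓ 333 = -1 := by
    have e : (333 : ℤ) = 9 * 37 := by norm_num
    rw [e, legendreSym.mul, hL9, hL37]; norm_num
  have hE := legendreSym.eq_pow ℓ 333
  rw [hL333] at hE
  have hdiv : ℓ / 2 = n * r := by
    have : ℓ = 2 * (n * r) + 1 := by rw [hℓr]; ring
    omega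
  rw [hdiv] at hE
  push_cast at hE ⊢
  exact hE.symm

end primes

/-! ## §3 The tool -/

section tool
variable {ι : Type*} [Fintype ι] [DecidableEq ι]

/-- **Twisted-trace lemma.**  An integer square matrix `M` with `M^(2n+1) = 333^n • M` and `37 ∤ n` has `tr M = 0`.
(Galois form: the eigenvalues are `0` or `√333·ζ`, `ζ^(2n) = 1`, and `√37 ∉ ℚ(ζ_{2n})`; kernel form: a prime
`ℓ ≡ 1 (mod 2n)`, `ℓ > |tr M|`, with `333` a non-residue gives `M^ℓ = −M` over `𝔽_ℓ` and `ℓ ∣ tr M`.) -/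
theorem trace_eq_zero_of_pow_eq_smul_333 (M : Matrix ι ι ℤ) (n : ℕ) (h37 : ¬ 37 ∣ n)
    (hM : M ^ (2 * n + 1) = (333 : ℤ) ^ n • M) : M.trace = 0 := by
  obtain ⟨ℓ, r, hℓp, hB, -, hℓr, hc⟩ := exists_prime_nonresidue_333 n h37 M.trace.natAbs
  have hdvd := prime_dvd_trace_of_pow_eq_smul hℓp M 333 n r hℓr hM hc
  refine Int.eq_zero_of_abs_lt_dvd hdvd ?_
  rw [Int.abs_eq_natAbs]
  exact_mod_cast hB

/-- The `n = 1` instance recovers the trace lemma of `ClassSumTrace` at `c = 333`: `M·M·M = 333·M ⇒ tr M = 0`. -/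
theorem trace_eq_zero_of_cube_eq_smul_333 (M : Matrix ι ι ℤ) (hM : M * M * M = (333 : ℤ) • M) : M.trace = 0 := by
  refine trace_eq_zero_of_pow_eq_smul_333 M 1 (by norm_num) ?_
  rw [pow_one, show 2 * 1 + 1 = 3 from rfl, pow_succ, pow_two, hM]

end tool

end Summit.Ventures.DiscreteObjects.Hadamard
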